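import Literature.AlgebraicGeometry.Motives.HodgeStructureEndAlgCentralizerUnitaryGeneration
import Literature.AlgebraicGeometry.Motives.HodgeStructureLefschetzGroupQuaternionBlocks
import Literature.AlgebraicGeometry.Motives.HodgeStructureEndAlgCentralizerBlocks
import Literature.AlgebraicGeometry.Motives.HodgeStructureEndAlgCentralizerInvolutionBlocks
import HarnessLib

/-!
# Milne 1999 §2–§3 on points, types I / II / III: "`C(A) = C₁ × ⋯ × C_t`, `Cᵢ = End_{Eᵢ}(Vᵢ)`, and the involution on `Cᵢ`
# sends an `Eᵢ`-endomorphism of `Vᵢ` to its adjoint with respect to `φᵢ`" — `(C(H)(K), †) ≃ ∏_{s ∈ Φ} (End_K(V_{K,τₛ}), †_{B_{τₛ}})`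
# for `E_φ = ℚ⟨ι(F), β⟩`, and "the `k`-algebra `C(A)` is generated by the `γ ∈ S(A)(k)`": `K[S(H)(K)] = C(H)(K)`

[topic AlgebraicGeometry/Motives]

Layer `Literature/AlgebraicGeometry/Motives`, lane `lit-hodgefound` (Track 2 foundations library; seat `lit-hodgefound-p34`,
generation 24, self-proposed row g24-#1), namespace `Literature.AlgebraicGeometry.Motives.HodgeStructure`. The sequel of the
seat's g23-#5 (`Motives/HodgeStructureEndAlgCentralizerUnitaryGeneration`: `K[S(H)(K)] = C(H)(K)` in the PAIRS case `σ ≠ 1` on the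
central field, via `(α, β)† = (βᵗʳ, αᵗʳ)`), which recorded as NOT done "the case `σ = 1` on `F` (types I/II/III: one block per
embedding with a symmetric / alternating form)". This file is that case: the ALGEBRA companions of the seat's group statements
`Motives/HodgeStructureLefschetzGroupQuaternionBlocks` (types II/III: `S(H)(K) ≃* ∏_{s ∈ Φ} Aut(V_{K,τₛ}, B_{τₛ})`) and
`Motives/HodgeStructureLefschetzGroupEigenspaceSplitting` §5 (type I: `S(H)(K) ≃* ∏_σ Sp(V_{K,σ})`), with the involution, and then
Milne's Lemma 3.5 (the tree's `Literature/RingTheory/SimpleModule/InvolutionUnitaryGeneration`, model pairs (b)/(c) and products)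
transported along them. DEFINITIONS WITH BODIES (`EndAction.centralizerRestrictBlocks`, `EndAction.twistedBlockFamily`,
`EndAction.centralizerBaseChangeAlgEquivTwistedBlocks`) + THEOREMS; no named fact, no `sorry` (D-0026, net debt `0`).

## The source, verbatim

J. S. Milne, *Lefschetz classes on abelian varieties*, Duke Math. J. **96** (1999) 639–675 [Milne1999LefschetzClasses] (held
text `paper:doi-10-1215-s0012-7094-99-09620-5`; Duke page = folio + 638; line numbers `Lnn` are those of the held page files
`p0010`–`p0012`, `p0004`–`p0006`, `p0015` as materialised 2026-08-26):
* (type I, p. 648 L37, L50–L58) "Simple abelian variety of type I. In this case `E = F`. […] Here `φᵢ` is a nondegenerate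
  skew-symmetric form on the `Fᵢ`-vector space `Vᵢ`. Therefore, `C(A) = C₁ × ⋯ × C_t`, `Cᵢ = End_{Fᵢ}(Vᵢ) ≈ M_{2g/f}(Fᵢ)` and the
  involution sends an element of `Cᵢ` to its adjoint with respect to `φᵢ`."; (p. 649 L17–L31) "`(V(A), φ) ⊗_k k^al =
  ⊕_{σ:F→k^al} (V_σ, φ_σ)` and `S(A)_{k^al} ≅ ∏_σ Sp(φ_σ)`".
* (type II, p. 649 L33–L38, L55–L64) "In this case `E` is a totally definite quaternion algebra over a totally real field `F`.
  Therefore, there exists a basis `1, α, β, αβ` for `E` with `α² = a ∈ F` […] `β² = b ∈ F` […] `αβ = −βα`. […] Here `Eᵢ` is a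
  quaternion algebra (possibly split) over `Fᵢ`, and `φᵢ` is a skew-Hermitian form `Vᵢ × Vᵢ → Eᵢ`. Therefore,
  `C(A) = C₁ × ⋯ × C_t`, `Cᵢ = End_{Eᵢ}(Vᵢ)` and the involution on `Cᵢ` sends an `Eᵢ`-endomorphism of `Vᵢ` to its adjoint with
  respect to `φᵢ`."; (p. 649 L65–L73) "Let `L = F[α]`. Then `E = L · 1 ⊕ L · β`, and so we can write `φ(x, y) = φ₁(x, y) +
  φ₂(x, y)β` […] Then `φ₁` is a skew-Hermitian form `V × V → L ⊗_ℚ k`, and `φ₂` is a skew-symmetric form. Any `L ⊗_ℚ k`-linear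
  automorphism of `V(A)` fixing `φ₁` and `φ₂` fixes `φ` and is `E ⊗_ℚ k`-linear³"; footnote 3 (p. 649 L95–L100) "`φ(βγx, γy) =
  βφ(γx, γy) = φ(βx, y) = φ(γβx, γy)` […] which implies that `βγ = γβ`, and hence that `γ` commutes with the action of
  `L[β] = E`."; (p. 650 L26–L36) "Let `σ₁, σ₂ : L → k^al` be the extensions of `σ` to `L`. Then `V_σ = V_{σ₁} ⊕ V_{σ₂}` […] and
  (see 2.2) `γ ↦ γ|V_{σ₁}` identifies `U(φ_{1,σ}) ∩ Sp(φ_{2,σ})` with `Sp(φ_{2,σ₁})`. The representation of `Sp(φ_{2,σ₁})` on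
  `V_{σ₁}` is its standard representation, and its representation on `V_{σ₂}` is the contragredient of the standard
  representation".
* (type III, p. 650 L37–L57) "This is similar to the preceding case […] In this case `β† = −β`, and `S(A) = ∏ᵢ Res U(φ_{1,i}) ∩
  Res O(φ_{2,i})` with `φ_{1,i}` a skew-Hermitian form […] and `φ_{2,i}` an `Lᵢ`-bilinear symmetric form. Moreover
  `S(A)_{k^al} ≅ ∏ O(φ_{2,σ₁})`".
* (§1 p. 642 L64–L70) "we let `β†` denote the adjoint with respect to `e_D` […] `e_D(βx, y) = e_D(x, β†y)` […] Then `β ↦ β†` is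
  an involution of the `k`-algebra `End_k(V(A))`"; (§1 p. 643 L5–L6) "`C(A)` is a `k`-algebra stable under the involution `†`";
  (§1 p. 644 L18) "`S(A)(R) = {γ ∈ C(A) ⊗_k R | γ†γ = 1}`"; (§3 p. 653 L42–L46) "The next lemma shows that the `k`-algebra
  `C(A)` is generated by the `γ ∈ S(A)(k)` […] **Lemma 3.5.** Any semisimple algebra with involution `(R, †)` of finite dimension
  over an algebraically closed field `k` is generated (as a `k`-algebra) by the subset `U` of elements `u` satisfying `u†u = 1`."

## Setting and dictionary (as in the seat's g22-#2 / g23-#5)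

`(H, Q)` a polarized `ℚ`-Hodge structure, a number field `F` (Milne's maximal subfield `L`; for type I, `F = E`) acting by
`A : EndAction H F`, an involution `σ` of `F` with the Rosati condition `hros : Q(ι(a)v, w) = Q(v, ι(σa)w)`, a field `K ⊇ ℚ` with
an injective family `τ : S → Hom(F, K)` of `card S = [F:ℚ]` embeddings, the index involution `κ` (`τ (κ s) = τ s ∘ σ`) and a set
`Φ ⊆ S` of representatives of its pairs (`hΦ₁`, `hΦ₂`) — for each `σ₀ : F₀ → K` the pair `{σ₁, σ₂}` of its extensions. Types
II/III: `β ∈ End_ℚ(V)` with `hβF : βι(a) = ι(σa)β`, `hβ2 : β² = ι(b)`, `b ≠ 0`, `hgen : E_φ = ℚ⟨ι(F), β⟩`; the twisted block form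
`B_{τₛ}(x, y) = Q_K(x, β_K y)` on `V_{K,τₛ}` (`Polarization.twistedBlockForm`, Milne's `φ_{2,σ₁}` read through `e_D = Tr ∘ φ`), which is
alternating / symmetric according to `Polarization.twistedBlockForm_swap`. `C(H)(K) = Subalgebra.centralizer K {a_K | a ∈ E_φ}`
("`C(A) ⊗_k K`"), `S(H)(K) = Q.lefschetzGroupBaseChange K`, `c† = Q.centralizerAdjoint K c` (the `Q_K`-adjoint).

## What is PROVED

* §1 DEF **`EndAction.centralizerRestrictBlocks : C(H)(K) →ₐ[K] ∏_{s ∈ Φ} End_K(V_{K,τₛ})`**, `c ↦ (c|V_{K,τₛ})ₛ` ("`γ ↦ γ|V_{σ₁}`"),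
  `EndAction.coe_centralizerRestrictBlocks_apply`.
* §2 `EndAction.baseChange_apply_mem_eigenspaceBaseChange_partnerIndex` / `…_of_mem_partnerIndex` (`β_K V_{K,τₜ} ⊆ V_{K,τ_{κt}}` and
  back), **`EndAction.centralizerRestrictBlocks_injective`** (for `β ∈ E_φ`: the representative blocks determine the element).
* §3 DEF **`EndAction.twistedBlockFamily`** (extension of `(g_s)_{s ∈ Φ}` to all blocks by `β`-conjugation
  `τ_{κt}(b)⁻¹ · β_K g_{κt} β_K` on the partner blocks), `…_of_mem`, `coe_…_apply_of_not_mem`,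
  `EndAction.eigenBlockSum_twistedBlockFamily_comm_baseChange` (its block sum commutes with `β_K` — footnote 3),
  `EndAction.eigenBlockSum_twistedBlockFamily_mem_centralizer`, **`EndAction.centralizerRestrictBlocks_surjective`**, DEF
  **`EndAction.centralizerBaseChangeAlgEquivTwistedBlocks : C(H)(K) ≃ₐ[K] ∏_{s ∈ Φ} End_K(V_{K,τₛ})`** ("`Cᵢ = End_{Eᵢ}(Vᵢ)`" on
  `K`-points, read through `L`: an `E_φ ⊗ K`-endomorphism is an ARBITRARY family of `K`-endomorphisms of the representative
  blocks), `coe_…_apply`.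
* §4 **`Polarization.centralizerRestrictBlocks_centralizerAdjoint`**: `(c†)|V_{K,τₛ} = adj_{B_{τₛ}}(c|V_{K,τₛ})` ("the involution on
  `Cᵢ` sends an `Eᵢ`-endomorphism of `Vᵢ` to its adjoint with respect to `φᵢ`"),
  `Polarization.centralizerAdjoint_mul_self_eq_one_iff_forall_mem_isometries` (`c†c = 1` iff every representative block is a
  `B_{τₛ}`-isometry).
* §5 `Polarization.twistedBlockForm_isSymm` / `_isAlt` (parity from `β† = ηβ`, `(-1)ⁿη = ±1`),
  **`Polarization.adjoin_setOf_centralizerAdjoint_mul_self_eq_one_eq_top_of_twisted`** (Lemma 3.5 for `(C(H)(K), †)`, types II/III,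
  `K` algebraically closed), **`Polarization.adjoin_coe_lefschetzGroupBaseChange_eq_centralizer_of_twisted`** (`K[S(H)(K)] =
  C(H)(K)`) and `…_of_adjoint_eq_smul` (the printed type II / III hypotheses `β† = ±β`).
* §6 type I (`E_φ = ι(F)`, `Q(ι(a)v, w) = Q(v, ι(a)w)`): `EndAction.central_of_endAlg_eq_range`,
  `Polarization.blockPairing_self_nondegenerate` ("`φᵢ` is a nondegenerate […] form on `Vᵢ`"),
  **`Polarization.centralizerBaseChangeAlgEquivBlockEnds_centralizerAdjoint`** (along the seat's type-I
  `EndAction.centralizerBaseChangeAlgEquivBlockEnds` of `Motives/HodgeStructureEndAlgCentralizerBlocks`: "the involution sends an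
  element of `Cᵢ` to its adjoint with respect to `φᵢ`"), `Polarization.blockPairing_self_isSymm` / `_isAlt` (even / odd weight),
  **`Polarization.adjoin_setOf_centralizerAdjoint_mul_self_eq_one_eq_top_of_endAlg_eq_range`**,
  **`Polarization.adjoin_coe_lefschetzGroupBaseChange_eq_centralizer_of_endAlg_eq_range`** (`K[S(H)(K)] = C(H)(K)`, type I).

NOT here (honest scope): that `E_φ` of a simple abelian variety of type II / III HAS the shape `ℚ⟨ι(L), β⟩` with these relations
and Rosati involutions (Albert's classification — hypotheses here, as in g22-#2); type IV with `d > 1` and `σ = 1` on the maximal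
real subfield (the pairs case is g23-#5); non-simple `E_φ` beyond these shapes; Milne's Lemma 3.5 for an ABSTRACT `(R, †)`; the
descent from `K = k^al` to `k`. HC is NOT proved; nothing here claims a case of the Hodge conjecture.

## References

* [Milne1999LefschetzClasses] J. S. Milne, *Lefschetz classes on abelian varieties*, Duke Math. J. 96 (1999) 639–675 — §1
  pp. 642–644, §2 pp. 648–650 (types I, II, III, footnote 3), §3 p. 653 (proof of Prop. 3.3, Lemma 3.5).
-/

noncomputable section

open scoped TensorProduct
open Function Module
open Literature.RingTheory.SimpleModule (adj eq_adj_of_forall isometries adj_mul_self_eq_one_iff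
  adjoin_pi_isometries_eq_top_of_isAlt adjoin_pi_isometries_eq_top_of_isSymm)

namespace Literature.AlgebraicGeometry.Motives

namespace HodgeStructure

universe u uK

variable {V : Type u} [AddCommGroup V] [Module ℚ V] {n : ℤ} {H : HodgeStructure V n}
variable {F : Type*} [Field F] [NumberField F]
variable (K : Type uK) [Field K] [Algebra ℚ K] (A : EndAction H F) {S : Type*} (τ : S → (F →ₐ[ℚ] K))
variable (Q : Polarization H) (σ : F ≃ₐ[ℚ] F) (β : Module.End ℚ V)

/-! ## §1 The restriction homomorphism `C(H)(K) → ∏_{s ∈ Φ} End_K(V_{K,τₛ})`, `c ↦ (c|V_{K,τₛ})_{s ∈ Φ}` -/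

section Restrict

variable (Φ : Finset S)

/-- **`c ↦ (c|V_{K,τₛ})_{s ∈ Φ}`**: the blocks of the elements of `C(H)(K) = Z_{End_K(K ⊗ V)}(E_φ ⊗ K)` on a set `Φ` of blocks,
as a `K`-algebra homomorphism (an element of `C(H)(K)` commutes with `ι(F) ⊗ K ⊆ E_φ ⊗ K`, so it preserves every block
`V_{K,χ}`; Milne's "`γ ↦ γ|V_{σ₁}`"). [cite: Milne1999LefschetzClasses, §2 p. 650 L33 ("γ ↦ γ|V_{σ₁} identifies U(φ_{1,σ}) ∩ Sp(φ_{2,σ}) with Sp(φ_{2,σ₁})") and p. 649 L61 ("Cᵢ = End_{Eᵢ}(Vᵢ)")] -/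
def EndAction.centralizerRestrictBlocks :
    Subalgebra.centralizer K ((fun a : Module.End ℚ V => a.baseChange K) '' (H.endAlg : Set (Module.End ℚ V))) →ₐ[K]
      ∀ s : Φ, A.BlockEnd K (τ s) where
  toFun c := fun s => A.restrictBlock K (c : Module.End K (K ⊗[ℚ] V))
    (fun a => baseChange_mul_eq_of_mem_centralizer K c.2 a.2) (τ s)
  map_one' := funext fun _ => LinearMap.ext fun _ => Subtype.ext rfl
  map_mul' _ _ := funext fun _ => LinearMap.ext fun _ => Subtype.ext rfl
  map_zero' := funext fun _ => LinearMap.ext fun _ => Subtype.ext rfl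
  map_add' _ _ := funext fun _ => LinearMap.ext fun _ => Subtype.ext rfl
  commutes' k := funext fun s => LinearMap.ext fun x => Subtype.ext (by
    change ((algebraMap K (Module.End K (K ⊗[ℚ] V)) k) (x : K ⊗[ℚ] V)) = ((algebraMap K (A.BlockEnd K (τ (s : S))) k x : _) : K ⊗[ℚ] V)
    rw [Module.algebraMap_end_apply, Module.algebraMap_end_apply, Submodule.coe_smul])

/-- The homomorphism IS restriction: `((c|)ₛ x) = c x` on `V_{K,τₛ}`. [cite: Milne1999LefschetzClasses, §2 p. 650 L33 ("γ ↦ γ|V_{σ₁}")] -/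
@[simp] theorem EndAction.coe_centralizerRestrictBlocks_apply
    (c : Subalgebra.centralizer K ((fun a : Module.End ℚ V => a.baseChange K) '' (H.endAlg : Set (Module.End ℚ V))))
    (s : Φ) (x : A.eigenspaceBaseChange K (τ s)) :
    ((A.centralizerRestrictBlocks K τ Φ c s x : A.eigenspaceBaseChange K (τ s)) : K ⊗[ℚ] V) =
      (c : Module.End K (K ⊗[ℚ] V)) x :=
  rfl

end Restrict

/-! ## §2 For `E_φ = ℚ⟨ι(F), β⟩`: an element of `C(H)(K)` is determined by its blocks on a set of representatives -/

section Partner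

variable [Fintype S] (κ : S → S) (Φ : Finset S)
variable (hτ : Injective τ) (hcard : Fintype.card S = finrank ℚ F) (hσ : ∀ a, σ (σ a) = a)
  (hκ : ∀ s, τ (κ s) = (τ s).comp (σ : F →ₐ[ℚ] F)) (hΦ₁ : ∀ s, s ∈ Φ ∨ κ s ∈ Φ) (hΦ₂ : ∀ s ∈ Φ, κ s ∉ Φ)
  (hβF : ∀ a, β * A.ι a = A.ι (σ a) * β) {b : F} (hb : b ≠ 0) (hβ2 : β * β = A.ι b)

omit [Fintype S] in
include hσ hκ hβF in
/-- `β_K V_{K,τₜ} ⊆ V_{K,τ_{κt}}` (`βι(a) = ι(σa)β`, `τ_{κt} = τₜ ∘ σ`). [cite: Milne1999LefschetzClasses, §2 p. 649 L38 ("αβ = −βα") and p. 650 L27 ("V_σ = V_{σ₁} ⊕ V_{σ₂}")] -/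
theorem EndAction.baseChange_apply_mem_eigenspaceBaseChange_partnerIndex (t : S) {x : K ⊗[ℚ] V}
    (hx : x ∈ A.eigenspaceBaseChange K (τ t)) : β.baseChange K x ∈ A.eigenspaceBaseChange K (τ (κ t)) := by
  rw [hκ t]
  exact A.baseChange_apply_mem_eigenspaceBaseChange_comp K σ β hβF hσ hx

omit [Fintype S] in
include hτ hσ hκ hβF in
/-- `β_K V_{K,τ_{κt}} ⊆ V_{K,τₜ}` (`κ (κ t) = t`). [cite: Milne1999LefschetzClasses, §2 p. 650 L27 ("V_σ = V_{σ₁} ⊕ V_{σ₂}")] -/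
theorem EndAction.baseChange_apply_mem_eigenspaceBaseChange_of_mem_partnerIndex (t : S) {x : K ⊗[ℚ] V}
    (hx : x ∈ A.eigenspaceBaseChange K (τ (κ t))) : β.baseChange K x ∈ A.eigenspaceBaseChange K (τ t) := by
  have h := A.baseChange_apply_mem_eigenspaceBaseChange_partnerIndex K τ σ β κ hσ hκ hβF (κ t) hx
  rwa [partnerIndex_partnerIndex K τ σ κ hτ hσ hκ t] at h

include hτ hcard hσ hκ hΦ₁ hβF hb hβ2 in
/-- **`c ↦ (c|V_{K,τₛ})_{s ∈ Φ}` is injective on `C(H)(K)` when `β ∈ E_φ`** (`βι(a) = ι(σa)β`, `β² = ι(b)`, `b ≠ 0`) and `Φ` meets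
every pair `{t, κt}`: on a partner block `V_{K,τₜ}`, `t ∉ Φ`, `β_K (c x) = c (β_K x)` with `β_K x ∈ V_{K,τ_{κt}}`, `κ t ∈ Φ`, and
`β_K` is injective — Milne's "`γ ↦ γ|V_{σ₁}` identifies …" (injectivity half). [cite: Milne1999LefschetzClasses, §2 p. 650 L27–L36] -/
theorem EndAction.centralizerRestrictBlocks_injective (hβ : β ∈ H.endAlg) :
    Injective (A.centralizerRestrictBlocks K τ Φ) := by
  intro c d hcd
  have hblock : ∀ (s : Φ) (x : K ⊗[ℚ] V), x ∈ A.eigenspaceBaseChange K (τ s) →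
      (c : Module.End K (K ⊗[ℚ] V)) x = (d : Module.End K (K ⊗[ℚ] V)) x := fun s x hx => by
    have h := congr_arg (fun g : ∀ s : Φ, A.BlockEnd K (τ s) => ((g s ⟨x, hx⟩ : A.eigenspaceBaseChange K (τ s)) : K ⊗[ℚ] V)) hcd
    simpa only [EndAction.coe_centralizerRestrictBlocks_apply] using h
  refine Subtype.ext (A.linearMap_eq_of_forall_apply_mem_eq K τ hτ hcard fun t x hx => ?_)
  rcases hΦ₁ t with ht | ht
  · exact hblock ⟨t, ht⟩ x hx
  · have hβx := A.baseChange_apply_mem_eigenspaceBaseChange_partnerIndex K τ σ β κ hσ hκ hβF t hx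
    have hc := LinearMap.congr_fun (baseChange_mul_eq_of_mem_centralizer K c.2 hβ) x
    have hd := LinearMap.congr_fun (baseChange_mul_eq_of_mem_centralizer K d.2 hβ) x
    simp only [Module.End.mul_apply] at hc hd
    -- `hc : β_K (c x) = c (β_K x)`, `hd : β_K (d x) = d (β_K x)`
    exact A.baseChange_injective_of_mul_self_eq K β hb hβ2 (by rw [hc, hd, hblock ⟨κ t, ht⟩ _ hβx])

/-! ## §3 Surjectivity: every family `(g_s)_{s ∈ Φ}` of blocks is the family of an element of `C(H)(K)` -/

variable [DecidableEq S]

omit [Fintype S] in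
/-- **The block family extending `(g_s)_{s ∈ Φ}` to all blocks**: `g_t` on a representative block `V_{K,τₜ}` (`t ∈ Φ`), and on a
partner block (`t ∉ Φ`, `κ t ∈ Φ`) the `β`-conjugate `τ_{κt}(b)⁻¹ · (β_K ∘ g_{κt} ∘ β_K)|V_{K,τₜ}` — the unique choice making the
block sum commute with `β_K` (`β² = ι(b)` acts on `V_{K,τ_{κt}}` as `τ_{κt}(b)`); Milne: the action on `V_{σ₂}` is determined by the
action on `V_{σ₁}`. [cite: Milne1999LefschetzClasses, §2 p. 650 L27–L36 ("V_σ = V_{σ₁} ⊕ V_{σ₂} … its representation on V_{σ₂} is the contragredient of the standard representation")] -/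
def EndAction.twistedBlockFamily (g : ∀ s : Φ, A.BlockEnd K (τ s)) (t : S) : A.BlockEnd K (τ t) :=
  if ht : t ∈ Φ then g ⟨t, ht⟩
  else (τ (κ t) b)⁻¹ •
    ((((β.baseChange K).restrict fun _ hx =>
        A.baseChange_apply_mem_eigenspaceBaseChange_of_mem_partnerIndex K τ σ β κ hτ hσ hκ hβF t hx) ∘ₗ
      g ⟨κ t, (hΦ₁ t).resolve_left ht⟩) ∘ₗ
      ((β.baseChange K).restrict fun _ hx =>
        A.baseChange_apply_mem_eigenspaceBaseChange_partnerIndex K τ σ β κ hσ hκ hβF t hx))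

omit [Fintype S] in
/-- On a representative block the family is `g_t`. [cite: Milne1999LefschetzClasses, §2 p. 650 L27–L36] -/
theorem EndAction.twistedBlockFamily_of_mem (g : ∀ s : Φ, A.BlockEnd K (τ s)) {t : S} (ht : t ∈ Φ) :
    A.twistedBlockFamily K τ σ β κ Φ hτ hσ hκ hΦ₁ hβF (b := b) g t = g ⟨t, ht⟩ :=
  dif_pos ht

omit [Fintype S] in
/-- On a partner block the family is `x ↦ τ_{κt}(b)⁻¹ β_K (g_{κt} (β_K x))`. [cite: Milne1999LefschetzClasses, §2 p. 650 L33–L36] -/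
theorem EndAction.coe_twistedBlockFamily_apply_of_not_mem (g : ∀ s : Φ, A.BlockEnd K (τ s)) {t : S} (ht : t ∉ Φ)
    (x : A.eigenspaceBaseChange K (τ t)) :
    ((A.twistedBlockFamily K τ σ β κ Φ hτ hσ hκ hΦ₁ hβF (b := b) g t x : A.eigenspaceBaseChange K (τ t)) : K ⊗[ℚ] V) =
      (τ (κ t) b)⁻¹ • β.baseChange K
        ((g ⟨κ t, (hΦ₁ t).resolve_left ht⟩
            ⟨β.baseChange K (x : K ⊗[ℚ] V), A.baseChange_apply_mem_eigenspaceBaseChange_partnerIndex K τ σ β κ hσ hκ hβF t x.2⟩ :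
          A.eigenspaceBaseChange K (τ (κ t))) : K ⊗[ℚ] V) := by
  rw [EndAction.twistedBlockFamily, dif_neg ht]
  rfl

include hcard hΦ₂ hb hβ2 in
/-- **The block sum `⊕ₜ Gₜ` of the extended family commutes with `β_K`.** On a partner block `V_{K,τₜ}` (`t ∉ Φ`) this is the
design of `Gₜ` (`β_K Gₜ x = τ_{κt}(b)⁻¹ β_K² g_{κt}(β_K x) = g_{κt}(β_K x)`); on a representative block it follows by applying the
injective `β_K` once more (`β_K (⊕G)(β_K y) = (⊕G)(β_K² y) = ι(b)_K (⊕G) y = β_K² (⊕G) y`). Milne, footnote 3: "which implies that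
`βγ = γβ`, and hence that `γ` commutes with the action of `L[β] = E`". [cite: Milne1999LefschetzClasses, §2 p. 649 footnote 3 (L95–L100) and p. 650 L27–L36] -/
theorem EndAction.eigenBlockSum_twistedBlockFamily_comm_baseChange (g : ∀ s : Φ, A.BlockEnd K (τ s)) (x : K ⊗[ℚ] V) :
    A.eigenBlockSum K τ (A.twistedBlockFamily K τ σ β κ Φ hτ hσ hκ hΦ₁ hβF (b := b) g) (β.baseChange K x) =
      β.baseChange K (A.eigenBlockSum K τ (A.twistedBlockFamily K τ σ β κ Φ hτ hσ hκ hΦ₁ hβF (b := b) g) x) := by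
  set G := A.twistedBlockFamily K τ σ β κ Φ hτ hσ hκ hΦ₁ hβF (b := b) g with hG
  -- (i) partner blocks
  have hpartner : ∀ t, t ∉ Φ → ∀ y ∈ A.eigenspaceBaseChange K (τ t),
      A.eigenBlockSum K τ G (β.baseChange K y) = β.baseChange K (A.eigenBlockSum K τ G y) := by
    intro t ht y hy
    have hκt : κ t ∈ Φ := (hΦ₁ t).resolve_left ht
    have hβy := A.baseChange_apply_mem_eigenspaceBaseChange_partnerIndex K τ σ β κ hσ hκ hβF t hy
    rw [A.eigenBlockSum_apply_of_mem K τ hτ hcard G hβy, A.eigenBlockSum_apply_of_mem K τ hτ hcard G hy, hG,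
      A.twistedBlockFamily_of_mem K τ σ β κ Φ hτ hσ hκ hΦ₁ hβF g hκt,
      A.coe_twistedBlockFamily_apply_of_not_mem K τ σ β κ Φ hτ hσ hκ hΦ₁ hβF g ht ⟨y, hy⟩, map_smul,
      A.baseChange_baseChange_apply_of_mul_self_eq K β hβ2,
      A.baseChange_ι_apply_of_mem_eigenspaceBaseChange K (g ⟨κ t, hκt⟩ _).2 b, smul_smul,
      inv_mul_cancel₀ ((map_ne_zero _).2 hb), one_smul]
  refine LinearMap.congr_fun (A.linearMap_eq_of_forall_apply_mem_eq K τ hτ hcard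
    (f := A.eigenBlockSum K τ G ∘ₗ β.baseChange K) (g := β.baseChange K ∘ₗ A.eigenBlockSum K τ G) fun t y hy => ?_) x
  rw [LinearMap.comp_apply, LinearMap.comp_apply]
  rcases em (t ∈ Φ) with ht | ht
  · -- (ii) representative blocks: apply `β_K` and use (i) on the partner block `κ t ∉ Φ`
    have hκt : κ t ∉ Φ := hΦ₂ t ht
    have hβy := A.baseChange_apply_mem_eigenspaceBaseChange_partnerIndex K τ σ β κ hσ hκ hβF t hy
    refine A.baseChange_injective_of_mul_self_eq K β hb hβ2 ?_
    rw [← hpartner (κ t) hκt _ hβy, A.baseChange_baseChange_apply_of_mul_self_eq K β hβ2,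
      A.baseChange_baseChange_apply_of_mul_self_eq K β hβ2, A.eigenBlockSum_comm K τ hτ hcard]
  · exact hpartner t ht y hy

/-- The operators on `V` whose base change to `K` commutes with a given `K`-linear `c` form a `ℚ`-subalgebra of `End_ℚ(V)`
(plumbing for "commutes with `ℚ⟨ι(F), β⟩ ⊗ K`"). [folklore] -/
private def baseChangeCommSubalgebra (c : Module.End K (K ⊗[ℚ] V)) : Subalgebra ℚ (Module.End ℚ V) where
  carrier := {a | a.baseChange K * c = c * a.baseChange K}
  mul_mem' {a a'} ha ha' := by
    change (a * a').baseChange K * c = c * (a * a').baseChange K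
    rw [LinearMap.baseChange_mul, mul_assoc, ha', ← mul_assoc, ha, mul_assoc]
  one_mem' := by
    change (1 : Module.End ℚ V).baseChange K * c = c * (1 : Module.End ℚ V).baseChange K
    rw [LinearMap.baseChange_one, one_mul, mul_one]
  add_mem' {a a'} ha ha' := by
    change (a + a').baseChange K * c = c * (a + a').baseChange K
    rw [LinearMap.baseChange_add, add_mul, mul_add, ha, ha']
  zero_mem' := by
    change (0 : Module.End ℚ V).baseChange K * c = c * (0 : Module.End ℚ V).baseChange K
    rw [LinearMap.baseChange_zero, zero_mul, mul_zero]
  algebraMap_mem' q := by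
    change (algebraMap ℚ (Module.End ℚ V) q).baseChange K * c = c * (algebraMap ℚ (Module.End ℚ V) q).baseChange K
    rw [Algebra.algebraMap_eq_smul_one, LinearMap.baseChange_smul, LinearMap.baseChange_one, smul_mul_assoc, one_mul,
      mul_smul_comm, mul_one]

include hcard hΦ₂ hb hβ2 in
/-- **The block sum of the extended family lies in `C(H)(K)`** for `E_φ = ℚ⟨ι(F), β⟩`: it commutes with every `ι(f)_K` (it is
block diagonal) and with `β_K`, hence with `E_φ ⊗ K` ("`γ` commutes with the action of `L[β] = E`"). [cite: Milne1999LefschetzClasses, §2 p. 649 L65–L73 and footnote 3 (L95–L100)] -/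
theorem EndAction.eigenBlockSum_twistedBlockFamily_mem_centralizer
    (hgen : Algebra.adjoin ℚ (insert β (Set.range A.ι)) = H.endAlg) (g : ∀ s : Φ, A.BlockEnd K (τ s)) :
    A.eigenBlockSum K τ (A.twistedBlockFamily K τ σ β κ Φ hτ hσ hκ hΦ₁ hβF (b := b) g) ∈
      Subalgebra.centralizer K ((fun a : Module.End ℚ V => a.baseChange K) '' (H.endAlg : Set (Module.End ℚ V))) := by
  set c := A.eigenBlockSum K τ (A.twistedBlockFamily K τ σ β κ Φ hτ hσ hκ hΦ₁ hβF (b := b) g) with hc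
  rw [Subalgebra.mem_centralizer_iff]
  rintro _ ⟨a, ha, rfl⟩
  have hle : H.endAlg ≤ baseChangeCommSubalgebra K c := by
    rw [← hgen]
    refine Algebra.adjoin_le (Set.insert_subset_iff.2 ⟨?_, ?_⟩)
    · change β.baseChange K * c = c * β.baseChange K
      exact LinearMap.ext fun x =>
        (A.eigenBlockSum_twistedBlockFamily_comm_baseChange K τ σ β κ Φ hτ hcard hσ hκ hΦ₁ hΦ₂ hβF hb hβ2 g x).symm
    · rintro _ ⟨f, rfl⟩
      change (A.ι f).baseChange K * c = c * (A.ι f).baseChange K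
      exact LinearMap.ext fun x => (A.eigenBlockSum_comm K τ hτ hcard _ f x).symm
  exact hle ha

include hτ hcard hσ hκ hΦ₁ hΦ₂ hβF hb hβ2 in
/-- **Surjectivity of `c ↦ (c|V_{K,τₛ})_{s ∈ Φ}` onto `∏_{s ∈ Φ} End_K(V_{K,τₛ})`** for `E_φ = ℚ⟨ι(F), β⟩` — Milne's "`γ ↦ γ|V_{σ₁}`
identifies …" (surjectivity half, for the ALGEBRA `C(A) ⊗ k^al` rather than the group `S(A)_{k^al}`).
[cite: Milne1999LefschetzClasses, §2 p. 650 L33–L36 and p. 649 L57–L61 ("C(A) = C₁ × ⋯ × C_t, Cᵢ = End_{Eᵢ}(Vᵢ)")] -/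
theorem EndAction.centralizerRestrictBlocks_surjective (hgen : Algebra.adjoin ℚ (insert β (Set.range A.ι)) = H.endAlg) :
    Surjective (A.centralizerRestrictBlocks K τ Φ) := fun g =>
  ⟨⟨_, A.eigenBlockSum_twistedBlockFamily_mem_centralizer K τ σ β κ Φ hτ hcard hσ hκ hΦ₁ hΦ₂ hβF hb hβ2 hgen g⟩,
    funext fun s => LinearMap.ext fun x => Subtype.ext (by
      rw [EndAction.coe_centralizerRestrictBlocks_apply]
      change A.eigenBlockSum K τ (A.twistedBlockFamily K τ σ β κ Φ hτ hσ hκ hΦ₁ hβF (b := b) g) (x : K ⊗[ℚ] V) = _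
      rw [A.eigenBlockSum_apply_of_mem K τ hτ hcard _ x.2,
        A.twistedBlockFamily_of_mem K τ σ β κ Φ hτ hσ hκ hΦ₁ hβF g s.2])⟩

include hτ hcard hσ hκ hΦ₁ hΦ₂ hβF hb hβ2 in
/-- **Milne's "`C(A) = C₁ × ⋯ × C_t`, `Cᵢ = End_{Eᵢ}(Vᵢ)`" for types II / III, on `K`-points, read through the maximal subfield:
`C(H)(K) ≃ₐ[K] ∏_{s ∈ Φ} End_K(V_{K,τₛ})`, `c ↦ (c|V_{K,τₛ})_{s ∈ Φ}`** — for `E_φ = ℚ⟨ι(F), β⟩` with `βι(a) = ι(σa)β`, `β² = ι(b)`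
(`b ≠ 0`), a field `K` admitting all `[F:ℚ]` embeddings `τₛ`, the index involution `κ` (`τ_{κs} = τₛ ∘ σ`) and a set `Φ` of
representatives of its pairs: an `E_φ ⊗ K`-endomorphism is a family of ARBITRARY `K`-endomorphisms of the representative blocks
(the algebra companion of the seat's `Polarization.lefschetzGroupBaseChangeEquivTwistedBlocks`, "`γ ↦ γ|V_{σ₁}` identifies
`U(φ_{1,σ}) ∩ Sp(φ_{2,σ})` with `Sp(φ_{2,σ₁})`", now for `C(A) ⊗ k^al = ∏_σ C_σ ⊗` instead of `S(A)_{k^al}`).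
[cite: Milne1999LefschetzClasses, §2 p. 649 L57–L61 ("C(A) = C₁ × ⋯ × C_t, Cᵢ = End_{Eᵢ}(Vᵢ)") and p. 650 L33–L36] -/
def EndAction.centralizerBaseChangeAlgEquivTwistedBlocks (hgen : Algebra.adjoin ℚ (insert β (Set.range A.ι)) = H.endAlg) :
    Subalgebra.centralizer K ((fun a : Module.End ℚ V => a.baseChange K) '' (H.endAlg : Set (Module.End ℚ V))) ≃ₐ[K]
      ∀ s : Φ, A.BlockEnd K (τ s) :=
  AlgEquiv.ofBijective (A.centralizerRestrictBlocks K τ Φ)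
    ⟨A.centralizerRestrictBlocks_injective K τ σ β κ Φ hτ hcard hσ hκ hΦ₁ hβF hb hβ2
        (by rw [← hgen]; exact Algebra.subset_adjoin (Set.mem_insert β _)),
      A.centralizerRestrictBlocks_surjective K τ σ β κ Φ hτ hcard hσ hκ hΦ₁ hΦ₂ hβF hb hβ2 hgen⟩

include hτ hcard hσ hκ hΦ₁ hΦ₂ hβF hb hβ2 in
/-- The equivalence IS restriction: `((equiv c) s) x = c x` on `V_{K,τₛ}`. [cite: Milne1999LefschetzClasses, §2 p. 650 L33 ("γ ↦ γ|V_{σ₁}")] -/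
@[simp] theorem EndAction.coe_centralizerBaseChangeAlgEquivTwistedBlocks_apply
    (hgen : Algebra.adjoin ℚ (insert β (Set.range A.ι)) = H.endAlg)
    (c : Subalgebra.centralizer K ((fun a : Module.End ℚ V => a.baseChange K) '' (H.endAlg : Set (Module.End ℚ V))))
    (s : Φ) (x : A.eigenspaceBaseChange K (τ s)) :
    ((A.centralizerBaseChangeAlgEquivTwistedBlocks K τ σ β κ Φ hτ hcard hσ hκ hΦ₁ hΦ₂ hβF hb hβ2 hgen c s x :
        A.eigenspaceBaseChange K (τ s)) : K ⊗[ℚ] V) = (c : Module.End K (K ⊗[ℚ] V)) x :=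
  rfl

end Partner

/-! ## §4 The involution: `(c†)|V_{K,τₛ}` is the adjoint of `c|V_{K,τₛ}` for `B_{τₛ}(x, y) = Q_K(x, β_K y)` — "the involution
on `Cᵢ` sends an `Eᵢ`-endomorphism of `Vᵢ` to its adjoint with respect to `φᵢ`" -/

section Involution

variable [Module.Finite ℚ V] (Φ : Finset S)

/-- **`(c†)|V_{K,τₛ} = (c|V_{K,τₛ})†_{B_{τₛ}}`**: for `c ∈ C(H)(K)` and `β ∈ E_φ`, the block of `c†` (`†` = the `Q_K`-adjoint,
`Polarization.centralizerAdjoint`) on `V_{K,τₛ}` is the adjoint of the block of `c` with respect to the twisted block form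
`B_{τₛ}(x, y) = Q_K(x, β_K y)` (`Q_K(c†x, βy) = Q_K(x, cβy) = Q_K(x, βcy)`): Milne's "the involution on `Cᵢ` sends an
`Eᵢ`-endomorphism of `Vᵢ` to its adjoint with respect to `φᵢ`", read on `V_{σ₁}` through `e_D = Tr ∘ φ` (the adjoint `adj` of
`Literature/RingTheory/SimpleModule/InvolutionWedderburnBlocks`, for any proof `hB` of non-degeneracy — e.g. the seat's
`Polarization.twistedBlockForm_nondegenerate`). [cite: Milne1999LefschetzClasses, §2 p. 649 L63–L64 ("the involution on Cᵢ sends an Eᵢ-endomorphism of Vᵢ to its adjoint with respect to φᵢ") and §1 p. 642 L64–L68] -/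
theorem Polarization.centralizerRestrictBlocks_centralizerAdjoint (hβ : β ∈ H.endAlg)
    (c : Subalgebra.centralizer K ((fun a : Module.End ℚ V => a.baseChange K) '' (H.endAlg : Set (Module.End ℚ V))))
    (s : Φ) (hB : (Q.twistedBlockForm K A β (τ s)).Nondegenerate) :
    A.centralizerRestrictBlocks K τ Φ (Q.centralizerAdjoint K c) s =
      adj (Q.twistedBlockForm K A β (τ s)) hB (A.centralizerRestrictBlocks K τ Φ c s) :=
  eq_adj_of_forall _ hB fun v w => by
    have hcβ := LinearMap.congr_fun (baseChange_mul_eq_of_mem_centralizer K c.2 hβ) (w : K ⊗[ℚ] V)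
    simp only [Module.End.mul_apply] at hcβ
    rw [Q.twistedBlockForm_apply K, Q.twistedBlockForm_apply K, EndAction.coe_centralizerRestrictBlocks_apply,
      EndAction.coe_centralizerRestrictBlocks_apply, Polarization.coe_centralizerAdjoint,
      Q.baseChange_form_adjointBaseChange_apply K, hcβ]

/-- **`c†c = 1` in `C(H)(K)` iff every representative block of `c` is a `B_{τₛ}`-isometry**, when the blocks on `Φ` determine
the element (`β ∈ E_φ`, the restriction homomorphism injective): `(c†c)|V_{K,τₛ} = (c|)†(c|)` and "`u†u = 1` iff `u` is an
isometry" (`adj_mul_self_eq_one_iff`). [cite: Milne1999LefschetzClasses, §1 p. 644 L18 ("S(A)(R) = {γ ∈ C(A) ⊗_k R | γ†γ = 1}") and §2 p. 650 L33] -/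
theorem Polarization.centralizerAdjoint_mul_self_eq_one_iff_forall_mem_isometries (hβ : β ∈ H.endAlg)
    (hinj : Injective (A.centralizerRestrictBlocks K τ Φ))
    (hB : ∀ s : Φ, (Q.twistedBlockForm K A β (τ s)).Nondegenerate)
    (c : Subalgebra.centralizer K ((fun a : Module.End ℚ V => a.baseChange K) '' (H.endAlg : Set (Module.End ℚ V)))) :
    Q.centralizerAdjoint K c * c = 1 ↔
      ∀ s : Φ, A.centralizerRestrictBlocks K τ Φ c s ∈ isometries (Q.twistedBlockForm K A β (τ s)) := by
  rw [← hinj.eq_iff, map_mul, map_one, funext_iff]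
  refine forall_congr' fun s => ?_
  rw [Pi.mul_apply, Pi.one_apply, Q.centralizerRestrictBlocks_centralizerAdjoint K A τ β Φ hβ c s (hB s),
    adj_mul_self_eq_one_iff _ (hB s)]

end Involution

/-! ## §5 Lemma 3.5 transported: `(C(H)(K), †)` is generated by its unitary elements, and `C(H)(K) = K[S(H)(K)]` (types II / III) -/

section Generation

variable [Fintype S] [Module.Finite ℚ V] (κ : S → S) (Φ : Finset S)
variable (hτ : Injective τ) (hcard : Fintype.card S = finrank ℚ F)
  (hros : ∀ a v w, Q.form (A.ι a v) w = Q.form v (A.ι (σ a) w)) (hσ : ∀ a, σ (σ a) = a)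
  (hκ : ∀ s, τ (κ s) = (τ s).comp (σ : F →ₐ[ℚ] F)) (hΦ₁ : ∀ s, s ∈ Φ ∨ κ s ∈ Φ) (hΦ₂ : ∀ s ∈ Φ, κ s ∉ Φ)
  (hβF : ∀ a, β * A.ι a = A.ι (σ a) * β) {b : F} (hb : b ≠ 0) (hβ2 : β * β = A.ι b)
  (hgen : Algebra.adjoin ℚ (insert β (Set.range A.ι)) = H.endAlg)

omit [Fintype S] [Module.Finite ℚ V] in
/-- **`B_χ` is symmetric** when `Q` is `ε`-symmetric, `β† = ηβ` and `εη = 1` (type III: odd weight, `β† = −β` — "`φ_{2,i}` an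
`Lᵢ`-bilinear symmetric form"). [cite: Milne1999LefschetzClasses, §2 p. 650 L42–L57 ("In this case β† = −β … an Lᵢ-bilinear symmetric form … O(φ_{2,σ₁})")] -/
theorem Polarization.twistedBlockForm_isSymm {η : ℚ} (hβadj : ∀ v w, Q.form (β v) w = η * Q.form v (β w))
    (hεη : (((n.negOnePow : ℤˣ) : ℤ) : ℚ) * η = 1) (χ : F →ₐ[ℚ] K) : (Q.twistedBlockForm K A β χ).IsSymm :=
  ⟨fun x y => by rw [Q.twistedBlockForm_swap K A β hβadj χ x y, hεη, map_one, one_mul]⟩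

omit [Fintype S] [Module.Finite ℚ V] in
/-- **`B_χ` is alternating** when `Q` is `ε`-symmetric, `β† = ηβ` and `εη = −1` (type II: odd weight, `β† = β` — "`φ₂` is a
skew-symmetric form … `Sp(φ_{2,σ₁})`"). [cite: Milne1999LefschetzClasses, §2 p. 649 L65–L70 ("φ₂ is a skew-symmetric form") and p. 650 L33] -/
theorem Polarization.twistedBlockForm_isAlt {η : ℚ} (hβadj : ∀ v w, Q.form (β v) w = η * Q.form v (β w))
    (hεη : (((n.negOnePow : ℤˣ) : ℤ) : ℚ) * η = -1) (χ : F →ₐ[ℚ] K) : (Q.twistedBlockForm K A β χ).IsAlt := by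
  intro x
  have h := Q.twistedBlockForm_swap K A β hβadj χ x x
  rw [hεη, map_neg, map_one, neg_one_mul, eq_neg_iff_add_eq_zero, ← two_mul, mul_eq_zero] at h
  refine h.resolve_left ?_
  rw [show (2 : K) = algebraMap ℚ K 2 by norm_num]
  exact (map_ne_zero (algebraMap ℚ K)).2 two_ne_zero

include σ κ hτ hcard hros hσ hκ hΦ₁ hΦ₂ hβF hb hβ2 hgen in
/-- **Milne's Lemma 3.5 for `(C(H)(K), †)` in the quaternion cases: `C(H)(K)` is generated as a `K`-algebra by its unitary
elements `{c | c†c = 1}`** — `E_φ = ℚ⟨ι(F), β⟩` as in §3, the Rosati condition for `σ`, `K` algebraically closed containing all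
embeddings of `F`, and all twisted block forms `B_{τₛ}` (`s ∈ Φ`) alternating (type (c)) or all symmetric (type (b)): transport of
the model statements `adjoin_pi_isometries_eq_top_of_isAlt` / `_of_isSymm` of `Literature/RingTheory/SimpleModule/InvolutionUnitaryGeneration`
along the `†`-compatible `C(H)(K) ≃ₐ[K] ∏_{s ∈ Φ} End_K(V_{K,τₛ})` of §3–§4. [cite: Milne1999LefschetzClasses, §3 Lemma 3.5 (p. 653 L44–L46) with §2 pp. 649–650 (types II, III)] -/
theorem Polarization.adjoin_setOf_centralizerAdjoint_mul_self_eq_one_eq_top_of_twisted [IsAlgClosed K]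
    (hB : (∀ s : Φ, (Q.twistedBlockForm K A β (τ s)).IsAlt) ∨ ∀ s : Φ, (Q.twistedBlockForm K A β (τ s)).IsSymm) :
    Algebra.adjoin K {c : Subalgebra.centralizer K ((fun a : Module.End ℚ V => a.baseChange K) ''
      (H.endAlg : Set (Module.End ℚ V))) | Q.centralizerAdjoint K c * c = 1} = ⊤ := by
  classical
  have hβ : β ∈ H.endAlg := by rw [← hgen]; exact Algebra.subset_adjoin (Set.mem_insert β _)
  set Ψ := A.centralizerBaseChangeAlgEquivTwistedBlocks K τ σ β κ Φ hτ hcard hσ hκ hΦ₁ hΦ₂ hβF hb hβ2 hgen with hΨ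
  have hnd : ∀ s : Φ, (Q.twistedBlockForm K A β (τ s)).Nondegenerate := fun s =>
    Q.twistedBlockForm_nondegenerate K A τ σ β κ hτ hcard hros hσ hκ hβF hb hβ2 s
  set U := {c : Subalgebra.centralizer K ((fun a : Module.End ℚ V => a.baseChange K) ''
      (H.endAlg : Set (Module.End ℚ V))) | Q.centralizerAdjoint K c * c = 1} with hU
  have h2 : (2 : K) ≠ 0 := by
    rw [show (2 : K) = algebraMap ℚ K 2 by norm_num]
    exact (map_ne_zero (algebraMap ℚ K)).2 two_ne_zero
  have key : ∀ c, c ∈ U ↔ ∀ s : Φ, Ψ c s ∈ isometries (Q.twistedBlockForm K A β (τ s)) := fun c =>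
    Q.centralizerAdjoint_mul_self_eq_one_iff_forall_mem_isometries K A τ β Φ hβ Ψ.injective hnd c
  have himage : (Ψ : _ → _) '' U = Set.univ.pi fun s : Φ => isometries (Q.twistedBlockForm K A β (τ s)) := by
    ext x
    rw [Set.mem_univ_pi]
    constructor
    · rintro ⟨c, hc, rfl⟩
      exact (key c).1 hc
    · intro hx
      refine ⟨Ψ.symm x, (key _).2 ?_, Ψ.apply_symm_apply x⟩
      simpa only [Ψ.apply_symm_apply] using hx
  have hmap : (Algebra.adjoin K U).map Ψ.toAlgHom = ⊤ := by
    rw [AlgHom.map_adjoin]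
    change Algebra.adjoin K ((Ψ : _ → _) '' U) = ⊤
    rw [himage]
    rcases hB with hBa | hBs
    · exact adjoin_pi_isometries_eq_top_of_isAlt h2 _ hnd hBa
    · exact adjoin_pi_isometries_eq_top_of_isSymm h2 _ hnd hBs
  refine eq_top_iff.2 fun c _ ↦ ?_
  have hc : Ψ.toAlgHom c ∈ (Algebra.adjoin K U).map Ψ.toAlgHom := hmap ▸ Algebra.mem_top
  obtain ⟨c', hc', hcc'⟩ := Subalgebra.mem_map.1 hc
  exact Ψ.injective hcc' ▸ hc'

include σ κ Φ hτ hcard hros hσ hκ hΦ₁ hΦ₂ hβF hb hβ2 hgen in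
/-- **"The `k`-algebra `C(A)` is generated by the `γ ∈ S(A)(k)`" on `K`-points, types II / III: `K[S(H)(K)] = C(H)(K)`** — the
`K`-subalgebra of `End_K(K ⊗ V)` generated by the Lefschetz group `S(H)(K)` is the whole centralizer `C(H)(K)` of `E_φ ⊗ K`, for
`E_φ = ℚ⟨ι(F), β⟩` as above with the twisted block forms all alternating or all symmetric, `K` algebraically closed containing all
embeddings of `F` (`S(H)(K)` = the unitary elements of `C(H)(K)`, FILE `…EndAlgCentralizerUnitaryGeneration` §1).
[cite: Milne1999LefschetzClasses, §3 p. 653 L42–L46 (proof of Prop. 3.3 via Lemma 3.5), types II / III of §2 pp. 649–650] -/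
theorem Polarization.adjoin_coe_lefschetzGroupBaseChange_eq_centralizer_of_twisted [IsAlgClosed K]
    (hB : (∀ s : Φ, (Q.twistedBlockForm K A β (τ s)).IsAlt) ∨ ∀ s : Φ, (Q.twistedBlockForm K A β (τ s)).IsSymm) :
    Algebra.adjoin K ((fun γ : (K ⊗[ℚ] V) ≃ₗ[K] (K ⊗[ℚ] V) => (γ : Module.End K (K ⊗[ℚ] V))) ''
        (Q.lefschetzGroupBaseChange K : Set _)) =
      Subalgebra.centralizer K ((fun a : Module.End ℚ V => a.baseChange K) '' (H.endAlg : Set (Module.End ℚ V))) := by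
  refine le_antisymm (Q.adjoin_coe_lefschetzGroupBaseChange_le K) ?_
  set C := Subalgebra.centralizer K ((fun a : Module.End ℚ V => a.baseChange K) '' (H.endAlg : Set (Module.End ℚ V)))
  have htop := Q.adjoin_setOf_centralizerAdjoint_mul_self_eq_one_eq_top_of_twisted K A τ σ β κ Φ hτ hcard hros hσ hκ hΦ₁
    hΦ₂ hβF hb hβ2 hgen hB
  have hval : (Algebra.adjoin K {c : C | Q.centralizerAdjoint K c * c = 1}).map C.val =
      Algebra.adjoin K (Subtype.val '' {c : C | Q.centralizerAdjoint K c * c = 1}) := AlgHom.map_adjoin _ _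
  rw [htop, Algebra.map_top, Subalgebra.range_val, ← Q.image_coe_lefschetzGroupBaseChange_eq K] at hval
  exact hval.le

include σ κ Φ hτ hcard hros hσ hκ hΦ₁ hΦ₂ hβF hb hβ2 hgen in
/-- **Types II and III as printed**: with `β† = ηβ` (`Q(βv, w) = η Q(v, βw)`) and `(-1)ⁿ η = ∓1` — type II (`β† = β`, odd
weight: `B` alternating, "`Sp(φ_{2,σ₁})`") or type III (`β† = −β`, odd weight: `B` symmetric, "`O(φ_{2,σ₁})`") — `K[S(H)(K)] = C(H)(K)`.
[cite: Milne1999LefschetzClasses, §3 p. 653 L42–L46 with §2 p. 649 L39 ("whose Rosati involution is γ ↦ γ† = αγ′α⁻¹") / p. 650 L42 ("β† = −β")] -/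
theorem Polarization.adjoin_coe_lefschetzGroupBaseChange_eq_centralizer_of_adjoint_eq_smul [IsAlgClosed K] {η : ℚ}
    (hβadj : ∀ v w, Q.form (β v) w = η * Q.form v (β w))
    (hεη : (((n.negOnePow : ℤˣ) : ℤ) : ℚ) * η = -1 ∨ (((n.negOnePow : ℤˣ) : ℤ) : ℚ) * η = 1) :
    Algebra.adjoin K ((fun γ : (K ⊗[ℚ] V) ≃ₗ[K] (K ⊗[ℚ] V) => (γ : Module.End K (K ⊗[ℚ] V))) ''
        (Q.lefschetzGroupBaseChange K : Set _)) =
      Subalgebra.centralizer K ((fun a : Module.End ℚ V => a.baseChange K) '' (H.endAlg : Set (Module.End ℚ V))) :=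
  Q.adjoin_coe_lefschetzGroupBaseChange_eq_centralizer_of_twisted K A τ σ β κ Φ hτ hcard hros hσ hκ hΦ₁ hΦ₂ hβF hb hβ2 hgen
    (hεη.imp (fun h s => Q.twistedBlockForm_isAlt K A β hβadj h (τ s)) fun h s => Q.twistedBlockForm_isSymm K A β hβadj h (τ s))

end Generation

/-! ## §6 Type I (`E_φ = ι(F)`, `σ = 1`): `(c†)|V_{K,τₜ}` is the `Q_K|V_{K,τₜ}`-adjoint of `c|V_{K,τₜ}`, and `C(H)(K) = K[S(H)(K)]` -/

section TypeI

variable [Fintype S] [Module.Finite ℚ V]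
variable (hτ : Injective τ) (hcard : Fintype.card S = finrank ℚ F)
  (hsym : ∀ a v w, Q.form (A.ι a v) w = Q.form v (A.ι a w)) (hE : H.endAlg = A.ι.range)

omit [Fintype S] [Module.Finite ℚ V] in
include hE in
/-- For `E_φ = ι(F)` the field `ι(F)` is (trivially) central in `E_φ` (plumbing for the type-I block decomposition
`EndAction.centralizerBaseChangeAlgEquivBlockEnds`). [cite: Milne1999LefschetzClasses, §2 p. 648 L37 ("Simple abelian variety of type I. In this case E = F")] -/
theorem EndAction.central_of_endAlg_eq_range : ∀ a ∈ H.endAlg, ∀ f : F, a * A.ι f = A.ι f * a := by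
  intro a ha f
  rw [hE] at ha
  obtain ⟨g, rfl⟩ := ha
  rw [AlgHom.toRingHom_eq_coe, RingHom.coe_coe, ← map_mul, ← map_mul, mul_comm]

include hτ hcard hsym in
/-- **Type I: `Q_K|V_{K,τₜ} × V_{K,τₜ}` is non-degenerate** — "`φᵢ` is a nondegenerate skew-symmetric form on the `Fᵢ`-vector
space `Vᵢ`" (the blocks are pairwise `Q_K`-orthogonal and `Q_K` is non-degenerate; the case `σ = 1`, `κ = 1` of the seat's perfect
pairing `Polarization.isPerfPair_blockPairing`). [cite: Milne1999LefschetzClasses, §2 p. 648 L50 ("φᵢ is a nondegenerate skew-symmetric form on the Fᵢ-vector space Vᵢ")] -/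
theorem Polarization.blockPairing_self_nondegenerate (t : S) :
    LinearMap.BilinForm.Nondegenerate (Q.blockPairing K A (τ t) (τ t)) := by
  have hκ : ∀ s, τ (id s) = (τ s).comp ((AlgEquiv.refl : F ≃ₐ[ℚ] F) : F →ₐ[ℚ] F) := fun s => AlgHom.ext fun _ => rfl
  have h := Q.isPerfPair_blockPairing K A τ AlgEquiv.refl id hτ hcard hsym (fun _ => rfl) hκ t
  rw [show (τ t).comp ((AlgEquiv.refl : F ≃ₐ[ℚ] F) : F →ₐ[ℚ] F) = τ t from AlgHom.ext fun _ => rfl] at h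
  refine ⟨fun x hx => h.bijective_left.injective ?_, fun y hy => h.bijective_right.injective ?_⟩
  · rw [map_zero]
    exact LinearMap.ext fun y => hx y
  · rw [map_zero]
    exact LinearMap.ext fun x => hy x

include hτ hcard hE in
/-- **Type I: "the involution sends an element of `Cᵢ` to its adjoint with respect to `φᵢ`"** — for `c ∈ C(H)(K)` the block of
`c†` on `V_{K,τₜ}` is the adjoint of the block of `c` for `Q_K|V_{K,τₜ}` (`Q_K(c†x, y) = Q_K(x, cy)`), along the type-I block
decomposition `EndAction.centralizerBaseChangeAlgEquivBlockEnds : C(H)(K) ≃ₐ[K] ∏ₜ End_K(V_{K,τₜ})` of the seat's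
`Motives/HodgeStructureEndAlgCentralizerBlocks` (for any proof `hB` of non-degeneracy, e.g. `blockPairing_self_nondegenerate`).
[cite: Milne1999LefschetzClasses, §2 p. 648 L51–L58 ("C(A) = C₁ × ⋯ × C_t, Cᵢ = End_{Fᵢ}(Vᵢ) … and the involution sends an element of Cᵢ to its adjoint with respect to φᵢ")] -/
theorem Polarization.centralizerBaseChangeAlgEquivBlockEnds_centralizerAdjoint
    (c : Subalgebra.centralizer K ((fun a : Module.End ℚ V => a.baseChange K) '' (H.endAlg : Set (Module.End ℚ V))))
    (t : S) (hB : LinearMap.BilinForm.Nondegenerate (Q.blockPairing K A (τ t) (τ t))) :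
    A.centralizerBaseChangeAlgEquivBlockEnds K τ hτ hcard (A.central_of_endAlg_eq_range hE) hE (Q.centralizerAdjoint K c) t =
      adj (Q.blockPairing K A (τ t) (τ t)) hB
        (A.centralizerBaseChangeAlgEquivBlockEnds K τ hτ hcard (A.central_of_endAlg_eq_range hE) hE c t) :=
  eq_adj_of_forall _ hB fun v w => by
    rw [Q.blockPairing_apply K, Q.blockPairing_apply K, EndAction.centralizerBaseChangeAlgEquivBlockEnds_apply_coe,
      EndAction.centralizerBaseChangeAlgEquivBlockEnds_apply_coe, Polarization.coe_centralizerAdjoint,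
      Q.baseChange_form_adjointBaseChange_apply K]

omit [Fintype S] [Module.Finite ℚ V] in
/-- **Parity of `Q_K|V_{K,χ}`**: symmetric for even weight. [cite: Milne1999LefschetzClasses, §1 p. 642 L62–L63 and Remark 1.6 (p. 644)] -/
theorem Polarization.blockPairing_self_isSymm (hn : Even n) (χ : F →ₐ[ℚ] K) :
    LinearMap.BilinForm.IsSymm (Q.blockPairing K A χ χ) :=
  ⟨fun x y => by
    rw [Q.blockPairing_apply K, Q.blockPairing_apply K, Q.baseChange_form_swap K (x : K ⊗[ℚ] V), Int.negOnePow_even n hn,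
      Units.val_one, Int.cast_one, one_mul]⟩

omit [Fintype S] [Module.Finite ℚ V] in
/-- **Parity of `Q_K|V_{K,χ}`**: alternating for odd weight ("a nondegenerate skew-symmetric form `φᵢ`" — abelian varieties, `n = 1`).
[cite: Milne1999LefschetzClasses, §2 p. 648 L50 and §1 p. 642 L62–L63] -/
theorem Polarization.blockPairing_self_isAlt (hn : Odd n) (χ : F →ₐ[ℚ] K) :
    LinearMap.BilinForm.IsAlt (Q.blockPairing K A χ χ) := by
  intro x
  have h := Q.baseChange_form_swap K (x : K ⊗[ℚ] V) (x : K ⊗[ℚ] V)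
  rw [Int.negOnePow_odd n hn, Units.val_neg, Units.val_one, Int.cast_neg, Int.cast_one, neg_one_mul,
    eq_neg_iff_add_eq_zero, ← two_mul, mul_eq_zero] at h
  rw [Q.blockPairing_apply K]
  refine h.resolve_left ?_
  rw [show (2 : K) = algebraMap ℚ K 2 by norm_num]
  exact (map_ne_zero (algebraMap ℚ K)).2 two_ne_zero

include hτ hcard hsym hE in
/-- **Milne's Lemma 3.5 for `(C(H)(K), †)`, type I: `C(H)(K)` is generated as a `K`-algebra by its unitary elements** —
`E_φ = ι(F)` with `Q(ι(a)v, w) = Q(v, ι(a)w)`, `K` algebraically closed containing all embeddings of `F`: along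
`C(H)(K) ≃ₐ[K] ∏ₜ End_K(V_{K,τₜ})` with `†` the `Q_K|V_{K,τₜ}`-adjoints (alternating for odd weight — type (c); symmetric for even
weight — type (b)). [cite: Milne1999LefschetzClasses, §3 Lemma 3.5 (p. 653 L44–L46) with §2 p. 648 L50–L58 (type I)] -/
theorem Polarization.adjoin_setOf_centralizerAdjoint_mul_self_eq_one_eq_top_of_endAlg_eq_range [IsAlgClosed K] :
    Algebra.adjoin K {c : Subalgebra.centralizer K ((fun a : Module.End ℚ V => a.baseChange K) ''
      (H.endAlg : Set (Module.End ℚ V))) | Q.centralizerAdjoint K c * c = 1} = ⊤ := by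
  classical
  set Ψ := A.centralizerBaseChangeAlgEquivBlockEnds K τ hτ hcard (A.central_of_endAlg_eq_range hE) hE with hΨ
  have hnd : ∀ t : S, LinearMap.BilinForm.Nondegenerate (Q.blockPairing K A (τ t) (τ t)) := fun t =>
    Q.blockPairing_self_nondegenerate K A τ hτ hcard hsym t
  set U := {c : Subalgebra.centralizer K ((fun a : Module.End ℚ V => a.baseChange K) ''
      (H.endAlg : Set (Module.End ℚ V))) | Q.centralizerAdjoint K c * c = 1} with hU
  have h2 : (2 : K) ≠ 0 := by
    rw [show (2 : K) = algebraMap ℚ K 2 by norm_num]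
    exact (map_ne_zero (algebraMap ℚ K)).2 two_ne_zero
  have key : ∀ c, c ∈ U ↔ ∀ t : S, Ψ c t ∈ isometries (Q.blockPairing K A (τ t) (τ t)) := fun c => by
    rw [hU, Set.mem_setOf_eq, ← Ψ.injective.eq_iff, map_mul, map_one, funext_iff]
    refine forall_congr' fun t => ?_
    rw [Pi.mul_apply, Pi.one_apply, hΨ, Q.centralizerBaseChangeAlgEquivBlockEnds_centralizerAdjoint K A τ hτ hcard hE c t (hnd t),
      adj_mul_self_eq_one_iff _ (hnd t)]
  have himage : (Ψ : _ → _) '' U = Set.univ.pi fun t : S => isometries (Q.blockPairing K A (τ t) (τ t)) := by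
    ext x
    rw [Set.mem_univ_pi]
    constructor
    · rintro ⟨c, hc, rfl⟩
      exact (key c).1 hc
    · intro hx
      refine ⟨Ψ.symm x, (key _).2 ?_, Ψ.apply_symm_apply x⟩
      simpa only [Ψ.apply_symm_apply] using hx
  have hmap : (Algebra.adjoin K U).map Ψ.toAlgHom = ⊤ := by
    rw [AlgHom.map_adjoin]
    change Algebra.adjoin K ((Ψ : _ → _) '' U) = ⊤
    rw [himage]
    rcases Int.even_or_odd n with hn | hn
    · exact adjoin_pi_isometries_eq_top_of_isSymm h2 _ hnd fun t => Q.blockPairing_self_isSymm K A hn (τ t)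
    · exact adjoin_pi_isometries_eq_top_of_isAlt h2 _ hnd fun t => Q.blockPairing_self_isAlt K A hn (τ t)
  refine eq_top_iff.2 fun c _ ↦ ?_
  have hc : Ψ.toAlgHom c ∈ (Algebra.adjoin K U).map Ψ.toAlgHom := hmap ▸ Algebra.mem_top
  obtain ⟨c', hc', hcc'⟩ := Subalgebra.mem_map.1 hc
  exact Ψ.injective hcc' ▸ hc'

include τ hτ hcard hsym hE in
/-- **"The `k`-algebra `C(A)` is generated by the `γ ∈ S(A)(k)`" on `K`-points, type I: `K[S(H)(K)] = C(H)(K)`** for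
`E_φ = ι(F)` with `Q(ι(a)v, w) = Q(v, ι(a)w)`, `K` algebraically closed containing all `[F:ℚ]` embeddings of `F`.
[cite: Milne1999LefschetzClasses, §3 p. 653 L42–L46 (proof of Prop. 3.3 via Lemma 3.5), type I of §2 p. 648] -/
theorem Polarization.adjoin_coe_lefschetzGroupBaseChange_eq_centralizer_of_endAlg_eq_range [IsAlgClosed K] :
    Algebra.adjoin K ((fun γ : (K ⊗[ℚ] V) ≃ₗ[K] (K ⊗[ℚ] V) => (γ : Module.End K (K ⊗[ℚ] V))) ''
        (Q.lefschetzGroupBaseChange K : Set _)) =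
      Subalgebra.centralizer K ((fun a : Module.End ℚ V => a.baseChange K) '' (H.endAlg : Set (Module.End ℚ V))) := by
  refine le_antisymm (Q.adjoin_coe_lefschetzGroupBaseChange_le K) ?_
  set C := Subalgebra.centralizer K ((fun a : Module.End ℚ V => a.baseChange K) '' (H.endAlg : Set (Module.End ℚ V)))
  have htop := Q.adjoin_setOf_centralizerAdjoint_mul_self_eq_one_eq_top_of_endAlg_eq_range K A τ hτ hcard hsym hE
  have hval : (Algebra.adjoin K {c : C | Q.centralizerAdjoint K c * c = 1}).map C.val =
      Algebra.adjoin K (Subtype.val '' {c : C | Q.centralizerAdjoint K c * c = 1}) := AlgHom.map_adjoin _ _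
  rw [htop, Algebra.map_top, Subalgebra.range_val, ← Q.image_coe_lefschetzGroupBaseChange_eq K] at hval
  exact hval.le

end TypeI

end HodgeStructure

end Literature.AlgebraicGeometry.Motives

end
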